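import Summits.BirchSwinnertonDyer.Rank1Residual.AdditivePotMult.PotMultX3BranchPAdicGrossZagierCertIff
import HarnessLib

/-!
# X3♯(M) ∧ `r_an = 1`, EVERY odd `p`: the CERT-literal iff from the census Q6 RECORD / one number — the
# X3♯(M) twin of n1011-p17's `PotMultBranchPAdicGrossZagierCertIffQ6.lean` (cell `b2b-bsdres`, team
# n1011, seat p12 (gen 2); one-liners over this seat's `PotMultX3BranchPAdicGrossZagierCertIff.lean`)

HONEST FRAMING (cell `b2b-bsdres`, run/shared/lean/b2b/bsd-rank1-residual/, verbatim in every
file): the goal of the cell is to DELETE the COMBINATION-SHAPED residual classes of the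
Birch–Swinnerton-Dyer formula for ALL analytic-rank `≤ 1` elliptic curves over `ℚ` — "full BSD
formula for every rank `≤ 1` curve in class `C`" assembled STRICTLY from published theorems — so
that the rank-`≤ 1` remainder becomes exactly the CONSTRUCTION-SHAPED classes, which are TYPED
(missing-input `Prop`s), NOT attempted. This is not "finishing BSD". Team n1011 (RESIDUAL-MAP §I
O7-ord, X3♯(M) share: X3 ∧ pot-mult(p) ∧ `r_an = 1`, every odd `p`): research route on the
CONSTRUCTION-SHAPED class O7; labels and marks UNCHANGED; nothing booked; NO Literature fact minted;
no definition. THEOREMS ONLY; named facts enter as HYPOTHESES (`hW16` = Wuthrich 2014 Thm. 16, REDUCIBLE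
`E[p]`; `hDelM` = `Delbourgo2002.mainTheorem_potMult`; `hPal` = Pal 2012 Thm. 3.2 on the EVEN branch
only; GZK `hGZK`; modularity `hmod`, `hmodD`). OUR conjecture as one side of the iff: p01's typed (M)
`p`-adic Gross–Zagier `BranchPAdicGrossZagierMultAt` (OPEN in rank one). EVIDENCE-tier input:
census-ctyper1's record `CensusQ6.Mult[Odd]FirstUnitIndexAt W p 1` / one unit linear coefficient.
No `_holds`; debt 0.

COVERAGE (stated first): per pair, `W/ℚ` globally minimal, `ClassX3M W p` (NO image hypothesis),
`ord_{s=1} L(E,s) = 1`, `Dh` a (B)-datum; §1: `p ≡ 3 (mod 4)` (Pal-free, `p = 3` included); §2: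
`p ≡ 1 (mod 4)` (with `hPal`); §3: `p = 3`. (The every-odd-`p` one-number form with `hPal`, the Pal-free
uniform-shape form and the `p = 3` record form are already in `PotMultX3BranchPAdicGrossZagierCertIff.lean`.)

## What (one-liners over `ClassX3M.branchPAdicGrossZagierMultAt_iff_bsdp_of_wuthrichHalf_of_multCert`)

* §1 `…_of_norm_minusCoeff_one` (census-literal odd shape: twist `−p`, `Ω⁻`, `L_p⁻`), `…_of_
  firstUnitIndex_one_of_mod_four_eq_three` (the Q6 odd RECORD at index `1` IS the certificate) and the
  `∀ Dh` form with Delbourgo (M) from the record.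
* §2 `…_of_firstUnitIndex_one_of_mod_four_eq_one` (Q6 even record; `hPal` as in p07's interlock).
* §3 `p = 3`: `…_three_iff_bsdp_of_wuthrichHalf_of_norm_minusCoeff_one`,
  `ClassX3M.bsdp_three_iff_forall_branchPAdicGrossZagierMultAt_of_wuthrichHalf_of_firstUnitIndex_one`.

References: [Wuthrich2014] Thm. 16 (p. 397); [Delbourgo2002] Thm. (A), (B) (p. 40);
[MazurTateTeitelbaum1986Invent] §I.13; [Pal2012] Thm. 3.2; [Miller2011LMS] Def. 1.1.
-/

noncomputable section

open scoped Classical MatrixGroups ModularForm NumberField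

namespace Summit.BirchSwinnertonDyer.Rank1Residual.AdditivePotMult

open CongruenceSubgroup WeierstrassCurve NumberField Literature.NumberTheory.EllipticCurves
  Literature.NumberTheory.EllipticCurves.ModularForms
  Literature.NumberTheory.EllipticCurves.Rank1Residual
  Literature.NumberTheory.EllipticCurves.Rank1Residual.Typed
  Literature.NumberTheory.EllipticCurves.Delbourgo2002
  Literature.NumberTheory.GaloisRepresentations
  Summit.BirchSwinnertonDyer.Rank1Residual.Additive
  IsDedekindDomain

/-! ### §1 Odd branch `p ≡ 3 (mod 4)`, Pal-free -/

section Odd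

variable {W : WeierstrassCurve ℚ} [W.IsElliptic] [W.IsGloballyMinimal] {p : ℕ} [hp : Fact p.Prime]

/-- **Census-literal odd shape** (`p ≡ 3 (mod 4)`; twist `−p`, `Ω⁻`, `L_p⁻`): X3♯(M) ∧ `r_an = 1`, `Dh` a
(B)-datum, Wuthrich `hW16`, and ONE unit linear coefficient of `ϖ·L_p⁻(f, a_p, ω^{(p−1)/2}, T)` on every
multiplicative model `V` of `E ⊗ χ_{−p}` ⟹ `BranchPAdicGrossZagierMultAt W p Dh ↔ BSDp W p`. NO `hPal`
(this seat's `multBranchUnitCertificateAt_of_norm_minusCoeff_one`). [cite: Wuthrich2014, Thm. 16 (p. 397)]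
[cite: Delbourgo2002, Theorem (B) (p. 40)] [cite: MazurTateTeitelbaum1986Invent, §I.13] [cite: Miller2011LMS, Def. 1.1] -/
theorem ClassX3M.branchPAdicGrossZagierMultAt_iff_bsdp_of_wuthrichHalf_of_norm_minusCoeff_one
    (hW16 : Wuthrich2014.thm16_halfEigenCharIdeal_dvd_cyclotomicPrime)
    (hmodD : nonempty_modularParametrizationData)
    (hGZK : rank_eq_analyticRank_of_analyticRank_le_one) (hmod : hasEntireLFunction_rat)
    (hp4 : p % 4 = 3) (hX : ClassX3M W p) (hr : W.analyticRank = 1)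
    (hone : ∀ (V : WeierstrassCurve ℚ) [V.IsElliptic] [V.IsGloballyMinimal] (C : VariableChange ℚ),
      Mult V p → C • V.quadraticTwist (-(p : ℚ)) = W →
      ∀ {N : ℕ} [NeZero N] (f : CuspForm (Gamma0 N) 2), IsNewformOf V f → ∀ (ap : ℤ), cuspCoeff f p = ap →
      ∀ ϖ : ℚ, (ϖ : ℝ) * V.imaginaryPeriodRat = minusPeriod f →
        ‖PowerSeries.coeff 1 (PowerSeries.C (ϖ : ℚ_[p]) *
            padicLFunctionMinusBranchMult f (ap : ℚ_[p]) (p / 2))‖ = 1)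
    {Dh : PAdicHeightData W p} (hB : LeadingTermClauses W p Dh) :
    BranchPAdicGrossZagierMultAt W p Dh ↔ BSDp W p :=
  hX.branchPAdicGrossZagierMultAt_iff_bsdp_of_wuthrichHalf_of_multCert hW16 hmodD hGZK hmod hr
    (multBranchUnitCertificateAt_of_norm_minusCoeff_one hmod hp4 hX.potMult.1
      (entireLFunction_one_eq_zero_of_analyticRank_ne_zero hmod (by rw [hr]; exact one_ne_zero)) hone)
    hB

/-- **The Q6 odd RECORD is the certificate** (`p ≡ 3 (mod 4)`): X3♯(M) ∧ `r_an = 1`, `Dh` a (B)-datum,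
`hW16` and census-ctyper1's record `CensusQ6.MultOddFirstUnitIndexAt W p 1` ⟹
`BranchPAdicGrossZagierMultAt W p Dh ↔ BSDp W p`. NO `hPal`. The record is EVIDENCE per pair.
[cite: Wuthrich2014, Thm. 16 (p. 397)] [cite: Delbourgo2002, Theorem (B) (p. 40)]
[cite: MazurTateTeitelbaum1986Invent, §I.13] [cite: Miller2011LMS, Def. 1.1] -/
theorem ClassX3M.branchPAdicGrossZagierMultAt_iff_bsdp_of_wuthrichHalf_of_firstUnitIndex_one_of_mod_four_eq_three
    (hW16 : Wuthrich2014.thm16_halfEigenCharIdeal_dvd_cyclotomicPrime)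
    (hmodD : nonempty_modularParametrizationData)
    (hGZK : rank_eq_analyticRank_of_analyticRank_le_one) (hmod : hasEntireLFunction_rat)
    (hp4 : p % 4 = 3) (hX : ClassX3M W p) (hr : W.analyticRank = 1)
    (hrec : CensusQ6.MultOddFirstUnitIndexAt W p 1)
    {Dh : PAdicHeightData W p} (hB : LeadingTermClauses W p Dh) :
    BranchPAdicGrossZagierMultAt W p Dh ↔ BSDp W p :=
  hX.branchPAdicGrossZagierMultAt_iff_bsdp_of_wuthrichHalf_of_multCert hW16 hmodD hGZK hmod hr
    (multBranchUnitCertificateAt_of_firstUnitIndex_one_of_mod_four_eq_three hmod hp4 hX.potMult.1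
      (entireLFunction_one_eq_zero_of_analyticRank_ne_zero hmod (by rw [hr]; exact one_ne_zero)) hrec)
    hB

/-- **`∀ Dh` form from the Q6 odd record, WITH Delbourgo 2002 (M)** (`p ≡ 3 (mod 4)`): X3♯(M) ∧ `r_an = 1`,
`hW16`, the record `CensusQ6.MultOddFirstUnitIndexAt W p 1` ⟹
`BSDp W p ↔ ∀ (B)-datum Dh, BranchPAdicGrossZagierMultAt W p Dh`. NO `hPal`.
[cite: Delbourgo2002, Theorem (A), (B) (p. 40)] [cite: Wuthrich2014, Thm. 16 (p. 397)] [cite: Miller2011LMS, Def. 1.1] -/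
theorem ClassX3M.bsdp_iff_forall_branchPAdicGrossZagierMultAt_of_wuthrichHalf_of_firstUnitIndex_one_of_mod_four_eq_three
    (hDelM : Delbourgo2002.mainTheorem_potMult)
    (hW16 : Wuthrich2014.thm16_halfEigenCharIdeal_dvd_cyclotomicPrime)
    (hmodD : nonempty_modularParametrizationData)
    (hGZK : rank_eq_analyticRank_of_analyticRank_le_one) (hmod : hasEntireLFunction_rat)
    (hp4 : p % 4 = 3) (hX : ClassX3M W p) (hr : W.analyticRank = 1)
    (hrec : CensusQ6.MultOddFirstUnitIndexAt W p 1) :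
    BSDp W p ↔ ∀ Dh : PAdicHeightData W p, LeadingTermClauses W p Dh →
      BranchPAdicGrossZagierMultAt W p Dh :=
  hX.bsdp_iff_forall_branchPAdicGrossZagierMultAt_of_wuthrichHalf_of_multCert hDelM hW16 hmodD hGZK hmod
    hr (multBranchUnitCertificateAt_of_firstUnitIndex_one_of_mod_four_eq_three hmod hp4 hX.potMult.1
      (entireLFunction_one_eq_zero_of_analyticRank_ne_zero hmod (by rw [hr]; exact one_ne_zero)) hrec)

end Odd

/-! ### §2 Even branch `p ≡ 1 (mod 4)`: the Q6 record (with `hPal`, as in p07's interlock) -/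

section Even

variable {W : WeierstrassCurve ℚ} [W.IsElliptic] [W.IsGloballyMinimal] {p : ℕ} [hp : Fact p.Prime]

/-- **The Q6 even RECORD is the certificate** (`p ≡ 1 (mod 4)`): X3♯(M) ∧ `r_an = 1`, `Dh` a (B)-datum,
`hW16`, Pal `hPal` (carried exactly as in p07's `multBranchUnitCertificateAt_of_firstUnitIndex_one`) and
census-ctyper1's record `CensusQ6.MultFirstUnitIndexAt W p 1` ⟹ `BranchPAdicGrossZagierMultAt W p Dh ↔ BSDp W p`.
[cite: Wuthrich2014, Thm. 16 (p. 397)] [cite: Pal2012, Thm. 3.2] [cite: Delbourgo2002, Theorem (B) (p. 40)]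
[cite: Miller2011LMS, Def. 1.1] -/
theorem ClassX3M.branchPAdicGrossZagierMultAt_iff_bsdp_of_wuthrichHalf_of_firstUnitIndex_one_of_mod_four_eq_one
    (hW16 : Wuthrich2014.thm16_halfEigenCharIdeal_dvd_cyclotomicPrime)
    (hPal : Pal2012.thm32_sqrt_mul_realPeriodRat_twist_eq_of_prime_one_mod_four)
    (hmodD : nonempty_modularParametrizationData)
    (hGZK : rank_eq_analyticRank_of_analyticRank_le_one) (hmod : hasEntireLFunction_rat)
    (hp4 : p % 4 = 1) (hX : ClassX3M W p) (hr : W.analyticRank = 1)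
    (hrec : CensusQ6.MultFirstUnitIndexAt W p 1)
    {Dh : PAdicHeightData W p} (hB : LeadingTermClauses W p Dh) :
    BranchPAdicGrossZagierMultAt W p Dh ↔ BSDp W p :=
  hX.branchPAdicGrossZagierMultAt_iff_bsdp_of_wuthrichHalf_of_multCert hW16 hmodD hGZK hmod hr
    (multBranchUnitCertificateAt_of_firstUnitIndex_one hPal hmod hp4 hX.potMult.1
      (entireLFunction_one_eq_zero_of_analyticRank_ne_zero hmod (by rw [hr]; exact one_ne_zero)) hrec)
    hB

end Even

/-! ### §3 `p = 3` (the X3♯(M)@3 rank-one rows; Pal-free, NO image hypothesis) -/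

section Three

variable {W : WeierstrassCurve ℚ} [W.IsElliptic] [W.IsGloballyMinimal] [hp : Fact (Nat.Prime 3)]

/-- **X3♯(M)@3, `r_an = 1`, one-number form**: `hW16` + ONE `3`-adic unit linear coefficient on every
multiplicative model of `E ⊗ χ_{−3}` (census-literal odd shape) ⟹ `BranchPAdicGrossZagierMultAt W 3 Dh ↔ BSDp W 3`.
Pal-free. [cite: Wuthrich2014, Thm. 16 (p. 397)] [cite: Delbourgo2002, Theorem (B) (p. 40)] [cite: Miller2011LMS, Def. 1.1] -/
theorem ClassX3M.branchPAdicGrossZagierMultAt_three_iff_bsdp_of_wuthrichHalf_of_norm_minusCoeff_one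
    (hW16 : Wuthrich2014.thm16_halfEigenCharIdeal_dvd_cyclotomicPrime)
    (hmodD : nonempty_modularParametrizationData)
    (hGZK : rank_eq_analyticRank_of_analyticRank_le_one) (hmod : hasEntireLFunction_rat)
    (hX : ClassX3M W 3) (hr : W.analyticRank = 1)
    (hone : ∀ (V : WeierstrassCurve ℚ) [V.IsElliptic] [V.IsGloballyMinimal] (C : VariableChange ℚ),
      Mult V 3 → C • V.quadraticTwist (-(3 : ℚ)) = W →
      ∀ {N : ℕ} [NeZero N] (f : CuspForm (Gamma0 N) 2), IsNewformOf V f → ∀ (ap : ℤ), cuspCoeff f 3 = ap →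
      ∀ ϖ : ℚ, (ϖ : ℝ) * V.imaginaryPeriodRat = minusPeriod f →
        ‖PowerSeries.coeff 1 (PowerSeries.C (ϖ : ℚ_[3]) *
            padicLFunctionMinusBranchMult f (ap : ℚ_[3]) (3 / 2))‖ = 1)
    {Dh : PAdicHeightData W 3} (hB : LeadingTermClauses W 3 Dh) :
    BranchPAdicGrossZagierMultAt W 3 Dh ↔ BSDp W 3 :=
  hX.branchPAdicGrossZagierMultAt_iff_bsdp_of_wuthrichHalf_of_norm_minusCoeff_one hW16 hmodD hGZK hmod
    (by decide) hr (by exact_mod_cast hone) hB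

/-- **X3♯(M)@3, `∀ Dh` form from the Q6 record WITH Delbourgo 2002 (M)**: `hW16` + the record
`CensusQ6.MultOddFirstUnitIndexAt W 3 1` ⟹ `BSDp W 3 ↔ ∀ (B)-datum Dh, BranchPAdicGrossZagierMultAt W 3 Dh`.
[cite: Delbourgo2002, Theorem (A), (B) (p. 40)] [cite: Wuthrich2014, Thm. 16 (p. 397)] [cite: Miller2011LMS, Def. 1.1] -/
theorem ClassX3M.bsdp_three_iff_forall_branchPAdicGrossZagierMultAt_of_wuthrichHalf_of_firstUnitIndex_one
    (hDelM : Delbourgo2002.mainTheorem_potMult)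
    (hW16 : Wuthrich2014.thm16_halfEigenCharIdeal_dvd_cyclotomicPrime)
    (hmodD : nonempty_modularParametrizationData)
    (hGZK : rank_eq_analyticRank_of_analyticRank_le_one) (hmod : hasEntireLFunction_rat)
    (hX : ClassX3M W 3) (hr : W.analyticRank = 1) (hrec : CensusQ6.MultOddFirstUnitIndexAt W 3 1) :
    BSDp W 3 ↔ ∀ Dh : PAdicHeightData W 3, LeadingTermClauses W 3 Dh →
      BranchPAdicGrossZagierMultAt W 3 Dh :=
  hX.bsdp_iff_forall_branchPAdicGrossZagierMultAt_of_wuthrichHalf_of_firstUnitIndex_one_of_mod_four_eq_three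
    hDelM hW16 hmodD hGZK hmod (by decide) hr hrec

end Three

end Summit.BirchSwinnertonDyer.Rank1Residual.AdditivePotMult

end
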